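import Literature.NumberTheory.EllipticCurves.TakahashiDegreeFormulaCoprimeProofs
import Literature.NumberTheory.EllipticCurves.TakahashiDegreeFormulaFromDictionaryProofs
import HarnessLib

/-!
# `stub_takahashi` (crux stmt-ABC-11338 `DefiniteXi.DefiniteRTControlPrime`) — ideator k1, gen 15
# FAMILY 1 (recognise & import): the stub ITEMISED as the tree's standard two-leaf split at `r ∥ N`

The stub `theorem stub_takahashi : takahashi2001_thm_2_3_of_coprime` is a reviewed NAMED FACT
(Takahashi 2001 Thm 2.3 at a prime `r ∥ N`, cofactor `M` arbitrary).  The tree already splits the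
SQUARE-FREE twin `takahashi2001_thm_2_3` into two printed leaves
(`TakahashiDegreeFormulaFromDictionary.lean`: multiplicity one + character-group dictionary,
assembled by `takahashi2001_thm_2_3_holds_of`) and proves the multiplicity-one leaf from
Eichler–Pizer data (`BrandtJL.finrank_eigenLattice_eq_one_of_eichlerPizerIso`, which carries NO
square-free hypothesis).  This sketch types the same split at coprime level and checks that the
tree's glue closes it:

* `H_R` `brandtEigenLattice_rank_one_of_coprime` — multiplicity one at level `(M, r)`, `gcd(M,r)=1`
  (Pizer 1980, Def. 1.2 "M any positive integer prime to p", Thm. 2.28 case `r = 0`, `k = 2`);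
* `H_D` `characterGroupDictionary_of_coprime` — the dictionary package at `r ∥ N` for the
  conductor-restricted optimal curve (Conrad–Stein 2001 Thm 6.1 + §7.1, `M` arbitrary; Kohel 2001
  Thm 4.3 at `D = 1`), i.e. `takahashi2001_characterGroupDictionary` with `Squarefree (M r)`
  replaced by `M.Coprime r` and minimality restricted to conductor `M r` (the stub's own idiom);
* `R`  `brandtEigenLattice_rank_one_of_coprime_of_eichlerPizerIso` — `H_R` from the EXISTENCE of
  Eichler–Pizer data at coprime level (PROVED here, 4 lines, tree theorem verbatim);
* `A`  `takahashi2001_thm_2_3_of_coprime_holds_of : H_R → H_D → stub` (PROVED here via the tree's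
  `takahashi2001_thm_2_3_of_coprime_of_brandtDictionary_one'`).

Nothing here asserts `H_R`, `H_D` or the existence of Eichler–Pizer data.
-/

set_option linter.dupNamespace false

noncomputable section

namespace Summit.ABC.ABC.Cruxes.DefiniteRTControlPrime.StubIdeas1G15

open scoped BigOperators
open Literature.NumberTheory.EllipticCurves Literature.NumberTheory.EllipticCurves.ModularForms
open Literature.NumberTheory.Automorphic

/-- `H_R` — multiplicity one for the Brandt eigen-lattice at coprime level `(M, r)`: for `W/ℚ`
elliptic of conductor `M r`, `r` prime, `gcd(M, r) = 1`, modular at level `M r`, and every Brandt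
setup `S` of type `(M, r)`, the `a(W)`-eigen-lattice of the Brandt matrices `T(p)`, `p ∤ M r`, has
`ℤ`-rank one.  Printed: Pizer 1980 (J. Algebra 64) Def. 1.2 (orders of level `p^{2r+1} M`, "`M` any
positive integer prime to `p`") and Thm. 2.28 (`⟨θ₁⟩ ⊕ ⋯ ⊕ ⟨θ_{H-1}⟩ ⊕ 2 S₂(M) ≅ S₂(pM)` as Hecke
modules away from `pM`), with Atkin–Lehner multiplicity one. -/
def brandtEigenLattice_rank_one_of_coprime : Prop :=
  ∀ (W : WeierstrassCurve ℚ) [W.IsElliptic] (M r : ℕ) [NeZero (M * r)],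
    r.Prime → M.Coprime r → W.conductorNorm ℤ = M * r →
    ∀ (_P : ModularParametrizationData W (M * r)) (S : Brandt.XiSetup M r)
      [Fintype (Brandt.ClassSet S.O)],
      Module.finrank ℤ
        (Brandt.eigenLattice (M * r) (Brandt.matrix S.O) (fun n => W.LFunction n)) = 1

/-- `H_D` — the character-group dictionary at `r ∥ N` (Takahashi 2001 §2 p. 78 / proof of Thm. 3.8
p. 84 at arbitrary cofactor: Conrad–Stein 2001 §2.1, Thm. 6.1, §7.1 "`N = Mp`, `M` arbitrary";
Kohel 2001 Thm. 4.3 at `D = 1`; Grothendieck SGA 7 IX 11.5): for the optimal curve among the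
conductor-`M r` curves with the same newform, in every Brandt setup of type `(M, r)` there are the
saturated character lattice `X ⊆ ℤ^{Cls O}`, `π^* : ℤ → X`, `π_* : X → ℤ`, adjoint for
`Σ_i w_i x_i y_i` and `c_r a b` with `c_r = ord_r Δ_min(W)`, `π_* π^* = δ`, `π_*` onto, and
`π^* 1` in the `a(W)`-eigen-lattice.  (= `takahashi2001_characterGroupDictionary` with
`Squarefree (M r)` ↦ `M.Coprime r` and conductor-restricted minimality.) -/
def characterGroupDictionary_of_coprime : Prop :=
  ∀ (W : WeierstrassCurve ℚ) [W.IsElliptic] (M r : ℕ) [NeZero (M * r)],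
    r.Prime → M.Coprime r → W.conductorNorm ℤ = M * r →
    ∀ P : ModularParametrizationData W (M * r),
      (∀ (W' : WeierstrassCurve ℚ) [W'.IsElliptic], W'.conductorNorm ℤ = M * r →
          ∀ P' : ModularParametrizationData W' (M * r),
          P'.f = P.f → P.modularDegree ≤ P'.modularDegree) →
      ∀ (S : Brandt.XiSetup M r) [Fintype (Brandt.ClassSet S.O)],
        ∃ (X : Submodule ℤ (Brandt.ClassSet S.O → ℤ)) (pb : ℤ →ₗ[ℤ] X) (pf : X →ₗ[ℤ] ℤ),
          (∀ (a : ℤ) (y : X),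
              ∑ i, (Brandt.weight S.O i : ℤ) * (pb a : Brandt.ClassSet S.O → ℤ) i *
                  (y : Brandt.ClassSet S.O → ℤ) i =
                ((W.minimalDiscriminantNorm ℤ).factorization r : ℤ) * a * pf y) ∧
          (∀ a : ℤ, pf (pb a) = (P.modularDegree : ℤ) * a) ∧
          Function.Surjective pf ∧
          (∀ (m : ℤ) (v : Brandt.ClassSet S.O → ℤ), m ≠ 0 → m • v ∈ X → v ∈ X) ∧
          (pb 1 : Brandt.ClassSet S.O → ℤ) ∈
            Brandt.eigenLattice (M * r) (Brandt.matrix S.O) (fun n => W.LFunction n)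

/-- `R` — **`H_R` from the existence of Eichler–Pizer data at coprime level** (the tree's
`BrandtJL.finrank_eigenLattice_eq_one_of_eichlerPizerIso` has no square-free hypothesis). PROVED. -/
theorem brandtEigenLattice_rank_one_of_coprime_of_eichlerPizerIso
    (h : ∀ (M r : ℕ) [NeZero M] [NeZero (M * r)], r.Prime → M.Coprime r →
      ∀ (S : Brandt.XiSetup M r) [Fintype (Brandt.ClassSet S.O)],
        Nonempty (BrandtJL.EichlerPizerIso S)) :
    brandtEigenLattice_rank_one_of_coprime := by
  intro W _ M r _ hr hcop hN P S _
  haveI : NeZero M := ⟨fun h0 => NeZero.ne (M * r) (by rw [h0, Nat.zero_mul])⟩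
  obtain ⟨E⟩ := h M r hr hcop S
  exact BrandtJL.finrank_eigenLattice_eq_one_of_eichlerPizerIso W M r hr.one_lt P S E

/-- `A` — **the stub from the two leaves** (coprime twin of `takahashi2001_thm_2_3_holds_of`),
through the tree's `takahashi2001_thm_2_3_of_coprime_of_brandtDictionary_one'`. PROVED. -/
theorem takahashi2001_thm_2_3_of_coprime_holds_of (h₁ : brandtEigenLattice_rank_one_of_coprime)
    (h₂ : characterGroupDictionary_of_coprime) : takahashi2001_thm_2_3_of_coprime := by
  refine takahashi2001_thm_2_3_of_coprime_of_brandtDictionary_one' ?_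
  intro W _ M r _ hr hcop hN P hmin hne
  obtain ⟨S₀⟩ := hne
  classical
  letI : Fintype (Brandt.ClassSet S₀.O) := Fintype.ofFinite _
  obtain ⟨X, pb, pf, hadj, hδ, hsurj, hXsat, hmem⟩ := h₂ W M r hr hcop hN P hmin S₀
  exact ⟨S₀, inferInstance, X, pb, pf, hadj, hδ, hsurj, hXsat, h₁ W M r hr hcop hN P S₀, hmem⟩

/-- The verbatim stub, CONDITIONALLY on the two leaves (shape a stub prover can land with
`--supports stmt-ABC-11338 --as helper`; the unconditional `theorem stub_takahashi` is not in reach). -/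
theorem stub_takahashi_of_leaves (h₁ : brandtEigenLattice_rank_one_of_coprime)
    (h₂ : characterGroupDictionary_of_coprime) : takahashi2001_thm_2_3_of_coprime :=
  takahashi2001_thm_2_3_of_coprime_holds_of h₁ h₂

/-- Sanity: the coprime leaves give back the tree's square-free leaves' assembly target too. -/
theorem takahashi2001_thm_2_3_of_coprime_leaves (h₁ : brandtEigenLattice_rank_one_of_coprime)
    (h₂ : characterGroupDictionary_of_coprime) : takahashi2001_thm_2_3 :=
  takahashi2001_thm_2_3_of_of_coprime (takahashi2001_thm_2_3_of_coprime_holds_of h₁ h₂)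

end Summit.ABC.ABC.Cruxes.DefiniteRTControlPrime.StubIdeas1G15

end
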